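import Summits.Ventures.PercRepro.C041RcPortCluster

/-!
# THEOREM R, the rc reduction: the `Good` dictionary (p6, gen 24; mine-3, C-041.md §3 / §6 (d))

Setting of `C041RcPortProb` / `C041RcPortCluster`.  For a configuration `S` of the red-connected-attachment family
(`RcAttach`: a vertex with a blue terminal edge has an rc zone) agreeing with `O` on the bare edges, with no blue edge
between the terminals, no doubly attached zone and the probe outside the blue cluster of `a`:

* `mem_A₁_iff_mem_cluster` — on `K`, the vertices deleted on side `1` by the pattern of `S` are exactly the blue
  cluster of `a` (a deleted zone is the zone of a blue neighbour of `a`, hence in the cluster; conversely a vertex of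
  `K` in the cluster lies in the zone of a blue neighbour `u` of `a`, which is rc, hence inside `K`, so `u` is a port
  vertex whose blue 1-edge deletes its zone);
* **`rc_good_a_iff`** — `Good_a S ↔ Good₁ (rcPattern S)`: a red walk from `c` to `b` avoiding the blue cluster of
  `a` is a red bare walk to a port vertex with a red 2-edge avoiding the deleted zones, and conversely;
* the same on the other side: `mem_A₂_iff_mem_cluster`, **`rc_good_b_iff`**.
-/

namespace PercRepro

namespace MultiGraph

open Finset ZonePort

variable {V E : Type*} {G : MultiGraph V E}

section Good

variable [Fintype V] {a b c : V} {O S : Config E} (hca : c ≠ a) (hcb : c ≠ b)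
  (hc : ∀ e, ¬ G.Joins e c a ∧ ¬ G.Joins e c b) (hne : a ≠ b)

/-- The red-connected-attachment condition: a vertex with a blue terminal edge has an rc zone. -/
def RcAttach (G : MultiGraph V E) (a b : V) (O S : Config E) : Prop :=
  ∀ u, (G.BlueTo a S u ∨ G.BlueTo b S u) → G.Rc a b O u

omit [Fintype V] in
/-- The red bare adjacency of `O` is that of `S`. -/
theorem rc_bareAdj_O_eq (hagree : G.AgreeBare a b O S) : G.BareAdj a b O = G.BareAdj a b S :=
  (bareAdj_congr hagree).symm

include hca hcb hc hne

/-- A zone deleted on side `1` lies in the blue cluster of `a`. -/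
theorem rc_mem_cluster_of_mem_A₁ (hagree : G.AgreeBare a b O S) {v : V}
    (hv : v ∈ (G.rcPort a b c O hca hcb hc).A₁ (rcPattern hca hcb hc S)) : v ∈ G.cluster Sᶜ a := by
  obtain ⟨t, hts, hxt, hvt⟩ := hv
  have hj : G.Joins t.1.1 (G.tvOf a b t.1.1) a := (ts_false_iff hca hcb hc hne t.1).1 hts
  have hu : G.BlueTo a S (G.tvOf a b t.1.1) := ⟨t.1.1, hj, hxt⟩
  rw [rcPort_tz] at hvt
  exact mem_cluster_compl_a_of_blueBareConn hagree hu
    ((mem_zone a b O).1 (portZone_subset_zone a b c O _ hvt))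

/-- A zone deleted on side `2` lies in the blue cluster of `b`. -/
theorem rc_mem_cluster_of_mem_A₂ (hagree : G.AgreeBare a b O S) {v : V}
    (hv : v ∈ (G.rcPort a b c O hca hcb hc).A₂ (rcPattern hca hcb hc S)) : v ∈ G.cluster Sᶜ b := by
  obtain ⟨t, hts, hxt, hvt⟩ := hv
  have hj : G.Joins t.1.1 (G.tvOf a b t.1.1) b := (ts_true_iff hca hcb hc hne t.1).1 hts
  have hu : G.BlueTo b S (G.tvOf a b t.1.1) := ⟨t.1.1, hj, hxt⟩
  rw [rcPort_tz] at hvt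
  exact mem_cluster_compl_b_of_blueBareConn hagree hu
    ((mem_zone a b O).1 (portZone_subset_zone a b c O _ hvt))

/-- **The deleted set on side `1` is the blue cluster of `a`, on `K`.** -/
theorem mem_A₁_iff_mem_cluster (hagree : G.AgreeBare a b O S) (hab : ∀ e, G.Joins e a b → S e = true)
    (hnd : G.NoDoubleZone a b O S) (hrc : G.RcAttach a b O S) (hcA : c ∉ G.cluster Sᶜ a) {v : V}
    (hvK : v ∈ G.BareReach a b c O) :
    v ∈ (G.rcPort a b c O hca hcb hc).A₁ (rcPattern hca hcb hc S) ↔ v ∈ G.cluster Sᶜ a := by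
  refine ⟨rc_mem_cluster_of_mem_A₁ hca hcb hc hne hagree, fun hv => ?_⟩
  rcases rc_cluster_compl_a_subset hagree hab hnd hv with hva | ⟨u, hu, huv⟩
  · exact absurd hva (bareReach_ne_terminal hca hcb O hvK).1
  obtain ⟨e, hj, hS⟩ := hu
  have hrcu : G.Rc a b O u := hrc u (Or.inl ⟨e, hj, hS⟩)
  have huK : u ∈ G.BareReach a b c O :=
    mem_bareReach_of_rc a b c O hrcu ((mem_zone a b O).2 huv) hvK (self_mem_zone a b O u)
  have hpv : G.IsPortVert a b c O u := ⟨huK, e, Or.inl hj⟩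
  let te : G.TE a b c O := ⟨e, u, hpv, Or.inl hj⟩
  have htv : G.tvOf a b e = u := tvOf_eq_of_portVert a b c O hca hcb hpv (Or.inl hj)
  refine ⟨toTerm hca hcb hc te, ?_, hS, ?_⟩
  · rw [ts_false_iff hca hcb hc hne]
    show G.Joins e (G.tvOf a b e) a
    rw [htv]
    exact hj
  · show v ∈ G.portZone a b c O (G.tvOf a b e)
    rw [htv]
    have hsw : G.Switchable a b c O u := by
      refine ⟨hrcu, fun hcu => hcA ?_⟩
      exact mem_cluster_compl_a_of_blueBareConn hagree ⟨e, hj, hS⟩ hcu.symm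
    rw [portZone_of_switchable a b c O hsw, mem_zone]
    exact huv

/-- **The deleted set on side `2` is the blue cluster of `b`, on `K`.** -/
theorem mem_A₂_iff_mem_cluster (hagree : G.AgreeBare a b O S) (hab : ∀ e, G.Joins e a b → S e = true)
    (hnd : G.NoDoubleZone a b O S) (hrc : G.RcAttach a b O S) (hcB : c ∉ G.cluster Sᶜ b) {v : V}
    (hvK : v ∈ G.BareReach a b c O) :
    v ∈ (G.rcPort a b c O hca hcb hc).A₂ (rcPattern hca hcb hc S) ↔ v ∈ G.cluster Sᶜ b := by
  refine ⟨rc_mem_cluster_of_mem_A₂ hca hcb hc hne hagree, fun hv => ?_⟩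
  rcases rc_cluster_compl_b_subset hagree hab hnd hv with hvb | ⟨u, hu, huv⟩
  · exact absurd hvb (bareReach_ne_terminal hca hcb O hvK).2
  obtain ⟨e, hj, hS⟩ := hu
  have hrcu : G.Rc a b O u := hrc u (Or.inr ⟨e, hj, hS⟩)
  have huK : u ∈ G.BareReach a b c O :=
    mem_bareReach_of_rc a b c O hrcu ((mem_zone a b O).2 huv) hvK (self_mem_zone a b O u)
  have hpv : G.IsPortVert a b c O u := ⟨huK, e, Or.inr hj⟩
  let te : G.TE a b c O := ⟨e, u, hpv, Or.inr hj⟩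
  have htv : G.tvOf a b e = u := tvOf_eq_of_portVert a b c O hca hcb hpv (Or.inr hj)
  refine ⟨toTerm hca hcb hc te, ?_, hS, ?_⟩
  · rw [ts_true_iff hca hcb hc hne]
    show G.Joins e (G.tvOf a b e) b
    rw [htv]
    exact hj
  · show v ∈ G.portZone a b c O (G.tvOf a b e)
    rw [htv]
    have hsw : G.Switchable a b c O u := by
      refine ⟨hrcu, fun hcu => hcB ?_⟩
      exact mem_cluster_compl_b_of_blueBareConn hagree ⟨e, hj, hS⟩ hcu.symm
    rw [portZone_of_switchable a b c O hsw, mem_zone]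
    exact huv

/-- A red bare walk of `O` avoiding the deleted set on side `1` is a red walk of `S` avoiding the blue cluster of
`a`, and stays in `K`. -/
theorem walk_of_bare_walk₁ (hagree : G.AgreeBare a b O S) (hab : ∀ e, G.Joins e a b → S e = true)
    (hnd : G.NoDoubleZone a b O S) (hrc : G.RcAttach a b O S) (hcA : c ∉ G.cluster Sᶜ a) :
    ∀ v, Relation.ReflTransGen
      (fun p q => G.BareAdj a b O p q ∧ q ∉ (G.rcPort a b c O hca hcb hc).A₁ (rcPattern hca hcb hc S)) c v →
      v ∈ G.BareReach a b c O ∧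
        Relation.ReflTransGen (fun x y => G.OpenAdj S x y ∧ y ∉ G.cluster Sᶜ a) c v := by
  intro v hv
  induction hv with
  | refl => exact ⟨Relation.ReflTransGen.refl, Relation.ReflTransGen.refl⟩
  | @tail p q _ hpq ih =>
    have hqK : q ∈ G.BareReach a b c O := ih.1.tail hpq.1
    refine ⟨hqK, ih.2.tail ⟨?_, ?_⟩⟩
    · have h : G.BareAdj a b S p q := by
        rw [← rc_bareAdj_O_eq hagree]
        exact hpq.1
      exact h.openAdj
    · intro hq
      exact hpq.2 ((mem_A₁_iff_mem_cluster hca hcb hc hne hagree hab hnd hrc hcA hqK).2 hq)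

/-- A red bare walk of `O` avoiding the deleted set on side `2` is a red walk of `S` avoiding the blue cluster of
`b`, and stays in `K`. -/
theorem walk_of_bare_walk₂ (hagree : G.AgreeBare a b O S) (hab : ∀ e, G.Joins e a b → S e = true)
    (hnd : G.NoDoubleZone a b O S) (hrc : G.RcAttach a b O S) (hcB : c ∉ G.cluster Sᶜ b) :
    ∀ v, Relation.ReflTransGen
      (fun p q => G.BareAdj a b O p q ∧ q ∉ (G.rcPort a b c O hca hcb hc).A₂ (rcPattern hca hcb hc S)) c v →
      v ∈ G.BareReach a b c O ∧
        Relation.ReflTransGen (fun x y => G.OpenAdj S x y ∧ y ∉ G.cluster Sᶜ b) c v := by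
  intro v hv
  induction hv with
  | refl => exact ⟨Relation.ReflTransGen.refl, Relation.ReflTransGen.refl⟩
  | @tail p q _ hpq ih =>
    have hqK : q ∈ G.BareReach a b c O := ih.1.tail hpq.1
    refine ⟨hqK, ih.2.tail ⟨?_, ?_⟩⟩
    · have h : G.BareAdj a b S p q := by
        rw [← rc_bareAdj_O_eq hagree]
        exact hpq.1
      exact h.openAdj
    · intro hq
      exact hpq.2 ((mem_A₂_iff_mem_cluster hca hcb hc hne hagree hab hnd hrc hcB hqK).2 hq)

/-- A red walk of `S` avoiding the blue cluster of `a` and the terminal `b` is a red bare walk of `O` avoiding the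
deleted set on side `1`, through non-terminals. -/
theorem bare_walk_of_walk₁ (hagree : G.AgreeBare a b O S) :
    ∀ v, Relation.ReflTransGen
      (fun x y => (G.OpenAdj S x y ∧ y ∉ G.cluster Sᶜ a) ∧ y ≠ b) c v →
      (v ≠ a ∧ v ≠ b) ∧ Relation.ReflTransGen
        (fun p q => G.BareAdj a b O p q ∧ q ∉ (G.rcPort a b c O hca hcb hc).A₁ (rcPattern hca hcb hc S)) c v := by
  intro v hv
  induction hv with
  | refl => exact ⟨⟨hca, hcb⟩, Relation.ReflTransGen.refl⟩
  | @tail x y _ hxy ih =>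
    have hya : y ≠ a := fun h => hxy.1.2 (by rw [h]; exact G.self_mem_cluster _ a)
    refine ⟨⟨hya, hxy.2⟩, ih.2.tail ⟨?_, ?_⟩⟩
    · rw [rc_bareAdj_O_eq hagree]
      exact bareAdj_of_openAdj hxy.1.1 ih.1 ⟨hya, hxy.2⟩
    · exact fun h => hxy.1.2 (rc_mem_cluster_of_mem_A₁ hca hcb hc hne hagree h)

/-- A red walk of `S` avoiding the blue cluster of `b` and the terminal `a` is a red bare walk of `O` avoiding the
deleted set on side `2`, through non-terminals. -/
theorem bare_walk_of_walk₂ (hagree : G.AgreeBare a b O S) :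
    ∀ v, Relation.ReflTransGen
      (fun x y => (G.OpenAdj S x y ∧ y ∉ G.cluster Sᶜ b) ∧ y ≠ a) c v →
      (v ≠ a ∧ v ≠ b) ∧ Relation.ReflTransGen
        (fun p q => G.BareAdj a b O p q ∧ q ∉ (G.rcPort a b c O hca hcb hc).A₂ (rcPattern hca hcb hc S)) c v := by
  intro v hv
  induction hv with
  | refl => exact ⟨⟨hca, hcb⟩, Relation.ReflTransGen.refl⟩
  | @tail x y _ hxy ih =>
    have hyb : y ≠ b := fun h => hxy.1.2 (by rw [h]; exact G.self_mem_cluster _ b)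
    refine ⟨⟨hxy.2, hyb⟩, ih.2.tail ⟨?_, ?_⟩⟩
    · rw [rc_bareAdj_O_eq hagree]
      exact bareAdj_of_openAdj hxy.1.1 ih.1 ⟨hxy.2, hyb⟩
    · exact fun h => hxy.1.2 (rc_mem_cluster_of_mem_A₂ hca hcb hc hne hagree h)

/-- **The `Good_a` dictionary** (C-041.md §3 / §6 (d), family `𝒮_rc(O)`): `b` is red-reachable from `c` avoiding the
blue cluster of `a` iff the zone port problem has `Good₁`. -/
theorem rc_good_a_iff (hagree : G.AgreeBare a b O S) (hab : ∀ e, G.Joins e a b → S e = true)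
    (hnd : G.NoDoubleZone a b O S) (hrc : G.RcAttach a b O S) (hcA : c ∉ G.cluster Sᶜ a) :
    G.WalkAvoiding S (G.cluster Sᶜ a) c b ↔
      (G.rcPort a b c O hca hcb hc).Good₁ (rcPattern hca hcb hc S) := by
  have hcA' : c ∉ (G.rcPort a b c O hca hcb hc).A₁ (rcPattern hca hcb hc S) :=
    fun h => hcA (rc_mem_cluster_of_mem_A₁ hca hcb hc hne hagree h)
  constructor
  · rintro ⟨_, hwalk⟩
    obtain ⟨w, ⟨hwb, _⟩, hcw⟩ := exists_last_step hwalk hcb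
    obtain ⟨hw, hbare⟩ := bare_walk_of_walk₁ hca hcb hc hne hagree w hcw
    have hwK : w ∈ G.BareReach a b c O := reflTransGen_mono' (fun _ _ h => h.1) hbare
    obtain ⟨e, hSe, hje⟩ := hwb
    have hje' : G.Joins e w b := hje
    have hpv : G.IsPortVert a b c O w := ⟨hwK, e, Or.inr hje'⟩
    let te : G.TE a b c O := ⟨e, w, hpv, Or.inr hje'⟩
    have htv : G.tvOf a b e = w := tvOf_eq_of_portVert a b c O hca hcb hpv (Or.inr hje')
    refine ⟨toTerm hca hcb hc te, ?_, hSe, c, Finset.mem_singleton_self c, hcA', ?_⟩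
    · rw [ts_true_iff hca hcb hc hne]
      show G.Joins e (G.tvOf a b e) b
      rw [htv]
      exact hje'
    · show Relation.ReflTransGen _ c (G.tvOf a b e)
      rw [htv]
      exact hbare
  · rintro ⟨t, hts, hxt, c', hc', hreach⟩
    rw [rcPort_root, Finset.mem_singleton] at hc'
    subst hc'
    have hj : G.Joins t.1.1 (G.tvOf a b t.1.1) b := (ts_true_iff hca hcb hc hne t.1).1 hts
    obtain ⟨_, hwalk⟩ := walk_of_bare_walk₁ hca hcb hc hne hagree hab hnd hrc hcA _ hreach.2
    refine ⟨hcA, hwalk.tail ⟨⟨t.1.1, hxt, hj⟩, rc_b_not_mem_cluster_compl_a hagree hab hnd hne⟩⟩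

/-- **The `Good_b` dictionary**: `a` is red-reachable from `c` avoiding the blue cluster of `b` iff the zone port
problem has `Good₂`. -/
theorem rc_good_b_iff (hagree : G.AgreeBare a b O S) (hab : ∀ e, G.Joins e a b → S e = true)
    (hnd : G.NoDoubleZone a b O S) (hrc : G.RcAttach a b O S) (hcB : c ∉ G.cluster Sᶜ b) :
    G.WalkAvoiding S (G.cluster Sᶜ b) c a ↔
      (G.rcPort a b c O hca hcb hc).Good₂ (rcPattern hca hcb hc S) := by
  have hcB' : c ∉ (G.rcPort a b c O hca hcb hc).A₂ (rcPattern hca hcb hc S) :=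
    fun h => hcB (rc_mem_cluster_of_mem_A₂ hca hcb hc hne hagree h)
  constructor
  · rintro ⟨_, hwalk⟩
    obtain ⟨w, ⟨hwa, _⟩, hcw⟩ := exists_last_step hwalk hca
    obtain ⟨hw, hbare⟩ := bare_walk_of_walk₂ hca hcb hc hne hagree w hcw
    have hwK : w ∈ G.BareReach a b c O := reflTransGen_mono' (fun _ _ h => h.1) hbare
    obtain ⟨e, hSe, hje⟩ := hwa
    have hje' : G.Joins e w a := hje
    have hpv : G.IsPortVert a b c O w := ⟨hwK, e, Or.inl hje'⟩
    let te : G.TE a b c O := ⟨e, w, hpv, Or.inl hje'⟩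
    have htv : G.tvOf a b e = w := tvOf_eq_of_portVert a b c O hca hcb hpv (Or.inl hje')
    refine ⟨toTerm hca hcb hc te, ?_, hSe, c, Finset.mem_singleton_self c, hcB', ?_⟩
    · rw [ts_false_iff hca hcb hc hne]
      show G.Joins e (G.tvOf a b e) a
      rw [htv]
      exact hje'
    · show Relation.ReflTransGen _ c (G.tvOf a b e)
      rw [htv]
      exact hbare
  · rintro ⟨t, hts, hxt, c', hc', hreach⟩
    rw [rcPort_root, Finset.mem_singleton] at hc'
    subst hc'
    have hj : G.Joins t.1.1 (G.tvOf a b t.1.1) a := (ts_false_iff hca hcb hc hne t.1).1 hts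
    obtain ⟨_, hwalk⟩ := walk_of_bare_walk₂ hca hcb hc hne hagree hab hnd hrc hcB _ hreach.2
    refine ⟨hcB, hwalk.tail ⟨⟨t.1.1, hxt, hj⟩, rc_a_not_mem_cluster_compl_b hagree hab hnd hne⟩⟩

end Good

end MultiGraph

end PercRepro
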